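import Mathlib
import HarnessLib
import Summits.NavierStokesRegularity.NavierStokesRegularity.Theses.IsobarTomography
import Summits.NavierStokesRegularity.NavierStokesRegularity.Theorems.IsobarTomographyTubeAlternativeGauge

/-!
# Crux-triage r1/k1 evidence — `TubeAlternative` (stmt-NavierStokesRegularity-11739)

Card `analytic-continuation-isobaric-defect`: its typed finite-order ladder `LadderRung m`
(Cruxes/TubeAlternative/SketchIdeator2.lean, copied VERBATIM below together with `isobaricDefect`,
`Antecedent`, `VanishesToOrder`, because the Cruxes module is not part of the farm build) omits the
non-slice-constancy conjunct, so EVERY rung is witnessed by the gauge family of spatially constant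
time profiles `v(t,x) = b(t)` (accepted p101533: `isKNSSBlowupLimit_timeProfile`,
`isClassicalNSSolutionOn_timeProfile`), whose isobaric defect is identically zero. Hence
`∀ m, LadderRung m` holds outright, independently of the antecedent, and the "ladder" as typed
carries none of the crux's content (which sits entirely in the fourth conjunct, cf.
`tubeConclusion_dropLast_timeProfile`).
-/

set_option linter.dupNamespace false

noncomputable section

namespace Summit.NavierStokesRegularity.NavierStokesRegularity.Cruxes.TubeAlternative.Triage

open Set Filter Topology Function
open scoped ContDiff RealInnerProductSpace
open Literature.Analysis.FluidPDE
open Summit.NavierStokesRegularity.NavierStokesRegularity.Theorems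

local notation "E3" => EuclideanSpace ℝ (Fin 3)

/-! ## Verbatim copies from Cruxes/TubeAlternative/SketchIdeator2.lean (namespace `…Ideator2`) -/

/-- (copy) The isobaric defect `F(s,y) = ⟪curl v(s) y, ∇q(s) y⟫`. -/
def isobaricDefect (v : ℝ → E3 → E3) (q : ℝ → E3 → ℝ) : ℝ × E3 → ℝ :=
  fun z => inner ℝ (curl (v z.1) z.2) (gradient (q z.1) z.2)

/-- (copy) The crux's antecedent packaged. -/
def Antecedent (ν T : ℝ) (u : ℝ → E3 → E3) (p : ℝ → E3 → ℝ) : Prop :=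
  0 < ν ∧ 0 < T ∧ IsMaximalSmoothSolution ν 0 u p T ∧ IsLerayHopfOn T ν 0 (u 0) u ∧
    HasRapidSpatialDecay (u 0) ∧ IsTypeIBlowup u T ∧
    ¬ ∃ κ : ℝ, 0 < κ ∧ ∃ Ω : ℝ → ℝ, ∃ t₀ ∈ Set.Ico 0 T, ∀ t ∈ Set.Ico t₀ T,
      (∃ x : E3, Ω t < ‖curl (u t) x‖) ∧ ∀ x : E3, Ω t < ‖curl (u t) x‖ →
        κ * ‖curl (u t) x‖ ^ 2 * Laplacian.laplacian (p t) x ≤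
          iteratedFDeriv ℝ 2 (p t) x ![curl (u t) x, curl (u t) x]

/-- (copy) `VanishesToOrder F z m`: all iterated derivatives of order `< m` vanish at `z`. -/
def VanishesToOrder (F : ℝ × E3 → ℝ) (z : ℝ × E3) (m : ℕ) : Prop :=
  ∀ n < m, iteratedFDeriv ℝ n F z = 0

/-- (copy) Rung `m` of the ladder. -/
def LadderRung (m : ℕ) : Prop :=
  ∀ (ν T : ℝ) (u : ℝ → E3 → E3) (p : ℝ → E3 → ℝ), Antecedent ν T u p →
    ∃ (v : ℝ → E3 → E3) (q : ℝ → E3 → ℝ), IsKNSSBlowupLimit v ∧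
      IsClassicalNSSolutionOn (Iio 0) 1 0 v q ∧
      ∃ z₀ : ℝ × E3, z₀.1 < 0 ∧ VanishesToOrder (isobaricDefect v q) z₀ m

/-! ## Triage facts -/

/-- The isobaric defect of a spatially constant time profile vanishes identically (its slices are
irrotational), whatever the pressure and at every time. -/
theorem isobaricDefect_timeProfile (b : ℝ → E3) (q : ℝ → E3 → ℝ) :
    isobaricDefect (fun t (_ : E3) => b t) q = 0 := by
  funext z
  have hc : curl (fun _ : E3 => b z.1) z.2 = 0 := by simp [curl]
  simp only [isobaricDefect, Pi.zero_apply]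
  rw [hc, inner_zero_left]

/-- **Every rung of the typed ladder holds, with no input from the antecedent.** For every `m`,
`LadderRung m` is witnessed by the (non-analytic) gauge profile `v(t,x) = χ(t+2) e₀`,
`q = -⟪b′(t), x⟫` of `exists_isKNSSBlowupLimit_not_analyticOnNhd` (p101533). -/
theorem ladderRung_all (m : ℕ) : LadderRung m := by
  intro ν T u p _
  set e₀ : E3 := EuclideanSpace.single 0 1 with he₀
  have he₀n : ‖e₀‖ = 1 := by simp [he₀]
  set b : ℝ → E3 := fun t => Real.smoothTransition (t + 2) • e₀ with hbdef
  have hb : ContDiff ℝ ∞ b :=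
    (Real.smoothTransition.contDiff.comp (contDiff_id.add contDiff_const)).smul contDiff_const
  have hnorm : ∀ t, ‖b t‖ = Real.smoothTransition (t + 2) := fun t => by
    simp only [hbdef, norm_smul, he₀n, mul_one, Real.norm_of_nonneg (Real.smoothTransition.nonneg _)]
  have h1 : ∀ t < 0, ‖b t‖ ≤ 1 := fun t _ => by
    rw [hnorm]; exact Real.smoothTransition.le_one _
  have hbm1 : b (-1) = e₀ := by
    simp only [hbdef]
    rw [Real.smoothTransition.one_of_one_le (by norm_num), one_smul]
  have h2 : ∀ ε : ℝ, 0 < ε → ∃ t < 0, 1 - ε < ‖b t‖ := fun ε hε =>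
    ⟨-1, by norm_num, by rw [hbm1, he₀n]; linarith⟩
  refine ⟨fun t _ => b t, fun t x => inner ℝ (-deriv b t) x, isKNSSBlowupLimit_timeProfile hb h1 h2,
    isClassicalNSSolutionOn_timeProfile hb, ((-1 : ℝ), (0 : E3)), by norm_num, ?_⟩
  intro n _
  rw [isobaricDefect_timeProfile]
  simp

/-- … and the same witness is slice-wise constant, so the rungs say nothing about the crux's
fourth conjunct. -/
theorem ladderRung_witness_sliceConstant (b : ℝ → E3) :
    ∀ t < 0, ∃ c : E3, (fun (t : ℝ) (_ : E3) => b t) t = fun _ => c :=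
  fun t _ => ⟨b t, rfl⟩

end Summit.NavierStokesRegularity.NavierStokesRegularity.Cruxes.TubeAlternative.Triage

end
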